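import Summits.Langlands.Langlands.Theses.AbelianSurfaceSerre
import Literature.NumberTheory.Automorphic.BCDTTheoremB
import Literature.NumberTheory.PAdicHodge.FontaineDpst
import Literature.NumberTheory.GaloisRepresentations.AbsGaloisOuterConj
import Literature.NumberTheory.GaloisRepresentations.LabelledHodgeTateWeights
-- (record form: the landed stubs' modules `Summits.Langlands.Langlands.Theorems.AbelianSurfaceSerreSerreGSp4SurjectiveStub…`
--  are not imported here; see the docstrings of stubs 1/7 and 2/7)

/-!
# Line `Sketch` for the crux `SerreGSp4Surjective` (stmt-Langlands-17765) — lead skeleton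

Crux: `Summit.Langlands.Langlands.Theses.AbelianSurfaceSerre.SerreGSp4Surjective` (Serre's conjecture
for `GSp₄/ℚ` in regular ordinary weight, level prime to `p`, for all `p ≥ p₀` and all `ρ̄` with image
ALL of `GSp(J)(𝔽_p)`, multiplier `ε̄⁻¹`, `ρ̄|Γ_{ℚ_p}` triangular with pairwise distinct diagonal).

Line (ideator-2 programme, cards `borel-void-skinner-wiles` (spine), `singer-type-evaporation`,
`unitary-detour-yoshida`): LEVEL ONE FIRST — for `ρ̄` unramified outside `p`, take a first lift that is
potentially crystalline of PARALLEL weight `{0,1,2,3}` with a Coxeter-torus tame type at `p` of order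
`d ∣ (p²+1)/2`, evaporate the type at the primes `P ∣ d` (all `P ≡ 1 (mod 4)`, `P ≥ 5`), reduce the
resulting level-one weight-`[0,3]` system at the FIXED prime `ℓ = 7`, where Fontaine's void forces a
cyclotomic-Borel, ordinary, `7`-distinguished residue, and conclude by a symplectic Skinner–Wiles theorem
for `GSp₄` at the Borel point (`BorelSkinnerWilesGSp4 7`); THEN LEVEL — a Khare-style induction on the
primes of the conductor with a Khare–Larsen–Savin scar, the ordinary Yoshida-type reducible residues met
on the way being handled by restriction to an imaginary quadratic field (polarisation,
`stub_restrictionIsPolarized`) and Allen–Newton–Thorne.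

Composition: `SerreGSp4Surjective_of` = case split of the crux's `ρ̄` into the line's slice
`IsSixGoodTame p ρ̄` (unramified above `2` and `3`, tamely ramified above every prime `q ≠ p`; the
card's "conductor coprime to 6, tame elsewhere") — closed by `stub_levelInduction ∘ stub_levelOne_of` —
and its complement (`stub_wildSlice`: `ρ̄` ramified above `2` or `3`, or wildly ramified above some
`q ≠ p`), for which the cards name NO engine (crux NOTES BN3). Stubs: 7 (`stubs_max`).

STATUS after wave 1 (lead cycle 1, 2026-08-17): stubs 1–2 LANDED (p147310 `stub_restrictionIsPolarized`,
p147171 `stub_coxeterOrderArith`; their `sorry`s below stand in for the import of the landed Theorems files); stub 3 was FALSE as first typed (sign of the residual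
exponents + missing regularity — repaired here: inverse cyclotomic powers, exact labelled weights
`{0,1,2,3}`); stubs 4–7 blocked/misstated with NO in-line repair: the LINE IS DEAD — see
`Lines/Sketch.dead.md` (Chenevier–Lannes vacuity of the level-one `ℓ = 7` endgame; transfer gap on the
wild slice; coefficient/shape-blind induction hypothesis the engines cannot produce). Kept as the record.
-/

namespace Summit.Langlands.Langlands.Cruxes.SerreGSp4Surjective.Sketch

open Literature.NumberTheory.GaloisRepresentations Literature.NumberTheory.Automorphic
  Literature.NumberTheory.PAdicHodge
open scoped NumberField
open IsDedekindDomain Polynomial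

noncomputable section

/-- `7` is prime (local instance for the engines at `ℓ = 7`). -/
local instance fact_prime_seven : Fact (Nat.Prime 7) := ⟨by norm_num⟩

/-! ## The crux's clauses, verbatim -/

section Clauses

variable (p : ℕ) [Fact p.Prime] (ρ : FramedGaloisRep ℚ (ZMod p) 4)

/-- (H1) of the crux, verbatim: `ρ̄` preserves a non-degenerate alternating form `J` up to the
multiplier `ε̄_p⁻¹` and its image is ALL of `GSp(J)(𝔽_p)`. -/
def FullSymplecticImage : Prop :=
  ∃ J : Matrix (Fin 4) (Fin 4) (ZMod p), J.transpose = -J ∧ IsUnit J.det ∧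
    (∀ g : Field.absoluteGaloisGroup ℚ, (ρ g).val.transpose * J * (ρ g).val =
      (((modPCyclotomicCharacterZMod ℚ p g)⁻¹ : (ZMod p)ˣ) : ZMod p) • J) ∧
    ∀ M : GL (Fin 4) (ZMod p), (∃ c : ZMod p, IsUnit c ∧ M.val.transpose * J * M.val = c • J) →
      M ∈ ρ.toMonoidHom.range

/-- The image-blind part of (H1): `ρ̄` is symplectic with multiplier `ε̄_p⁻¹` (tree predicate
`IsSymplecticWithMultiplierFun`, unfolded it is the first three conjuncts of (H1)). -/
def SymplecticInvCyclo : Prop :=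
  ρ.IsSymplecticWithMultiplierFun fun g =>
    (((modPCyclotomicCharacterZMod ℚ p g)⁻¹ : (ZMod p)ˣ) : ZMod p)

/-- (H2) of the crux, verbatim: at every `v ∣ p`, `ρ̄|Γ_{ℚ_v}` is upper-triangularisable over `𝔽̄_p`
with pairwise distinct diagonal characters (ordinary `p`-distinguished shape). -/
def OrdinaryDistinguishedAt : Prop :=
  ∀ v : HeightOneSpectrum (𝓞 ℚ), ((p : ℕ) : 𝓞 ℚ) ∈ v.asIdeal →
    ∃ g : GL (Fin 4) (AlgebraicClosure (ZMod p)),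
      (∀ (τ : Field.absoluteGaloisGroup (v.adicCompletion ℚ)) (i j : Fin 4), j < i →
        (g.val * ((ρ.toLocal v τ).val.map (algebraMap (ZMod p) (AlgebraicClosure (ZMod p)))) *
          (g⁻¹).val) i j = 0) ∧
      ∀ i j : Fin 4, i ≠ j → ∃ τ : Field.absoluteGaloisGroup (v.adicCompletion ℚ),
        (g.val * ((ρ.toLocal v τ).val.map (algebraMap (ZMod p) (AlgebraicClosure (ZMod p)))) *
            (g⁻¹).val) i i ≠
          (g.val * ((ρ.toLocal v τ).val.map (algebraMap (ZMod p) (AlgebraicClosure (ZMod p)))) *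
            (g⁻¹).val) j j

/-- The conclusion of the crux, verbatim: a regular algebraic cuspidal `π` on `GL₄(𝔸_ℚ)` unramified at
`p`, `ι : ℚ̄_p ≃ ℂ` and a framed `r : Γ_ℚ → GL₄(ℚ̄_p)`, Satake–Frobenius compatible with `(π, ι)` a.e.
(HLTT, `m = 4`), symplectic, crystalline-ordinary of strictly increasing shape at `p`, whose integral
characteristic polynomials reduce to those of `ρ̄ ⊗ 𝔽̄_p`. -/
def RegularOrdinaryModular : Prop :=
  ∃ (hcpt : isCompact_glFiniteIntegralLevel 4 ℚ) (π : CuspidalAutomorphicRepData 4 ℚ hcpt)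
    (ι : PadicAlgCl p ≃+* ℂ) (r : FramedGaloisRep ℚ (PadicAlgCl p) 4),
    π.1.IsRegularAlgebraic ∧
    (∀ v : HeightOneSpectrum (𝓞 ℚ), ((p : ℕ) : 𝓞 ℚ) ∈ v.asIdeal →
      π.1.IsUnramifiedAt v ∧ ∃ a : Fin 4 → ℕ, StrictMono a ∧ r.IsCrystallineOrdinaryOfShapeAt v a) ∧
    (∀ᶠ v : HeightOneSpectrum (𝓞 ℚ) in Filter.cofinite, ∃ a : Multiset ℂ,
      π.1.HasSatakeParamAt v a ∧ r.IsUnramifiedAt v ∧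
        r.HasFrobCharpolyAt v (arithFrobPolyOfSatake ι v.residueCard 4 a)) ∧
    (∃ ν : Field.absoluteGaloisGroup ℚ → PadicAlgCl p, r.IsSymplecticWithMultiplierFun ν) ∧
    ∃ red : (Valued.v : Valuation (PadicAlgCl p) NNReal).valuationSubring →+*
        AlgebraicClosure (ZMod p),
      ∀ g : Field.absoluteGaloisGroup ℚ,
        ∃ P : Polynomial (Valued.v : Valuation (PadicAlgCl p) NNReal).valuationSubring,
          P.map (Valued.v : Valuation (PadicAlgCl p) NNReal).valuationSubring.subtype =
              FramedRep.charpoly r g ∧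
            P.map red = (FramedRep.charpoly ρ g).map (algebraMap (ZMod p) (AlgebraicClosure (ZMod p)))

/-- The line's slice of the crux: `ρ̄` is unramified above `2` and `3` and tamely ramified above every
prime `q ≠ p` ("conductor coprime to `6`, tame elsewhere" — card `borel-void-skinner-wiles`, §Transfer;
tree predicates `FramedGaloisRep.IsUnramifiedAt`, `FramedGaloisRep.IsTamelyRamifiedAbove`). -/
def IsSixGoodTame : Prop :=
  (∀ v : HeightOneSpectrum (𝓞 ℚ),
      ((2 : ℕ) : 𝓞 ℚ) ∈ v.asIdeal ∨ ((3 : ℕ) : 𝓞 ℚ) ∈ v.asIdeal → ρ.IsUnramifiedAt v) ∧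
    ∀ q : ℕ, q.Prime → q ≠ p → ρ.IsTamelyRamifiedAbove q

end Clauses

/-- The crux is literally `∃ p₀, ∀ p ≥ p₀, ∀ ρ̄, (H1) → (H2) → conclusion` in the clauses above. -/
theorem serreGSp4Surjective_iff :
    Summit.Langlands.Langlands.Theses.AbelianSurfaceSerre.SerreGSp4Surjective ↔
      ∃ p₀ : ℕ, ∀ (p : ℕ) [Fact p.Prime], p₀ ≤ p → ∀ ρ : FramedGaloisRep ℚ (ZMod p) 4,
        FullSymplecticImage p ρ → OrdinaryDistinguishedAt p ρ → RegularOrdinaryModular p ρ :=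
  Iff.rfl

/-- (H1) contains the image-blind symplectic clause. -/
theorem FullSymplecticImage.symplecticInvCyclo {p : ℕ} [Fact p.Prime]
    {ρ : FramedGaloisRep ℚ (ZMod p) 4} (h : FullSymplecticImage p ρ) : SymplecticInvCyclo p ρ := by
  obtain ⟨J, hJt, hJu, hJ, -⟩ := h
  exact ⟨J, hJt, hJu, hJ⟩

/-! ## The slice statements the composition consumes -/

/-- C⁺ restricted to what the crux needs: the crux on the line's slice `IsSixGoodTame`. -/
def TameSliceSerre : Prop :=
  ∃ p₀ : ℕ, ∀ (p : ℕ) [Fact p.Prime], p₀ ≤ p → ∀ ρ : FramedGaloisRep ℚ (ZMod p) 4,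
    FullSymplecticImage p ρ → OrdinaryDistinguishedAt p ρ → IsSixGoodTame p ρ →
      RegularOrdinaryModular p ρ

/-- The complement slice: `ρ̄` ramified above `2` or `3`, or wildly ramified above some prime `q ≠ p`.
No card of the line supplies an engine here (crux NOTES BN3: wild ramification at `2`, `3` forces a
passage through residual characteristic `2`/`3`; no `GSp₄` lifting theorem with uncontrolled residual
image there is in print; the tame-at-`2`,`3` part is GRH-conditional via the void's discriminant budget). -/
def WildSliceSerre : Prop :=
  ∃ p₀ : ℕ, ∀ (p : ℕ) [Fact p.Prime], p₀ ≤ p → ∀ ρ : FramedGaloisRep ℚ (ZMod p) 4,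
    FullSymplecticImage p ρ → OrdinaryDistinguishedAt p ρ → ¬ IsSixGoodTame p ρ →
      RegularOrdinaryModular p ρ

/-- LEVEL ONE FIRST (card `borel-void-skinner-wiles` (5), Khare 2006 architecture), in the image-blind
form the level induction consumes: for `p ≥ p₀`, every `ρ̄ : Γ_ℚ → GL₄(𝔽_p)` symplectic with multiplier
`ε̄⁻¹`, of ordinary `p`-distinguished shape at `p` and UNRAMIFIED OUTSIDE `p`, satisfies the crux's
conclusion. (Reducible `ρ̄` are deliberately included by the card — the terminal Skinner–Wiles engine is
meant to carry them; `-- TODO(general form): coefficients in any finite field of characteristic p`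
(crux NOTES BN1: the induction meets residue fields `𝔽_{q^f}`).) -/
def LevelOneSerre : Prop :=
  ∃ p₀ : ℕ, ∀ (p : ℕ) [Fact p.Prime], p₀ ≤ p → ∀ ρ : FramedGaloisRep ℚ (ZMod p) 4,
    SymplecticInvCyclo p ρ → OrdinaryDistinguishedAt p ρ →
      (∀ v : HeightOneSpectrum (𝓞 ℚ), ((p : ℕ) : 𝓞 ℚ) ∉ v.asIdeal → ρ.IsUnramifiedAt v) →
        RegularOrdinaryModular p ρ

/-! ## The two engines at the fixed prime `ℓ = 7` (typed; both UNPROVED in the tree) -/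

section Engines

variable (ℓ : ℕ) [Fact ℓ.Prime]

/-- `r : Γ_ℚ → GL₄(ℚ̄_ℓ)` is **residually cyclotomic-Borel of exponents `a`**: its integral
characteristic polynomials reduce, along some `red : 𝒪_{ℚ̄_ℓ} → 𝔽̄_ℓ`, to `∏ᵢ (X - ε̄_ℓ(g)^{-a i})`
(i.e. `r̄^ss ≅ ⊕ᵢ ε̄^{-a i}`, INVERSE powers: `ε` has Hodge–Tate weight `-1` in the tree, so the
constituent of weight `a i` reduces to `ε̄^{-a i}` — wave-1 correction; the crux's own reduction device). -/
def IsResiduallyCyclotomicBorel (r : FramedGaloisRep ℚ (PadicAlgCl ℓ) 4) (a : Fin 4 → ℕ) : Prop :=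
  ∃ red : (Valued.v : Valuation (PadicAlgCl ℓ) NNReal).valuationSubring →+* AlgebraicClosure (ZMod ℓ),
    ∀ g : Field.absoluteGaloisGroup ℚ,
      ∃ P : Polynomial (Valued.v : Valuation (PadicAlgCl ℓ) NNReal).valuationSubring,
        P.map (Valued.v : Valuation (PadicAlgCl ℓ) NNReal).valuationSubring.subtype =
            FramedRep.charpoly r g ∧
          P.map red = ∏ i : Fin 4,
            (X - C (algebraMap (ZMod ℓ) (AlgebraicClosure (ZMod ℓ))
              ((((modPCyclotomicCharacterZMod ℚ ℓ g)⁻¹ : (ZMod ℓ)ˣ) : ZMod ℓ) ^ a i)))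

/-- **Fontaine's void in Borel form at `ℓ`** (Fontaine 1993 "Schémas propres et lisses sur ℤ" Thm 1,
Abrashkin 1989, + the Fontaine–Laffaille step "niveau-1 reduction ⇒ ordinary"): a symplectic
`r : Γ_ℚ → GL₄(ℚ̄_ℓ)` unramified outside `ℓ` and crystalline at `ℓ` with labelled Hodge–Tate weights
EXACTLY `{0,1,2,3}` (relative to the summit's pinned Fontaine datum `fontainePstAdicCompletion v ℓ hv`;
wave-1 correction: a mere bound `[0,3]` lets `r = 1` in) is residually cyclotomic-Borel of exponents
`(0,1,2,3)` and crystalline-ordinary of shape `(0,1,2,3)` at `ℓ`. Intended at `ℓ = 7`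
(rd < 7^{3/2} = 18.52 < 22.38, unconditional in print) and `ℓ = 5`. UNPROVED in the tree; its only
consumer in this line is vacuous (see `Lines/Sketch.dead.md`). -/
def FontaineVoidBorel : Prop :=
  ∀ r : FramedGaloisRep ℚ (PadicAlgCl ℓ) 4,
    (∃ ν : Field.absoluteGaloisGroup ℚ → PadicAlgCl ℓ, r.IsSymplecticWithMultiplierFun ν) →
    (∀ v : HeightOneSpectrum (𝓞 ℚ), ((ℓ : ℕ) : 𝓞 ℚ) ∉ v.asIdeal → r.IsUnramifiedAt v) →
    (∀ (v : HeightOneSpectrum (𝓞 ℚ)) (hv : ((ℓ : ℕ) : 𝓞 ℚ) ∈ v.asIdeal),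
      (fontainePstAdicCompletion v ℓ hv).IsCrystallineFramed (r.toLocal v) ∧
        ∀ τ : v.adicCompletion ℚ →+* PadicAlgCl ℓ,
          r.labelledHodgeTateWeightsAt v (fontainePstAdicCompletion v ℓ hv).algebra
            (fontainePstAdicCompletion v ℓ hv).𝔅 τ = {0, 1, 2, 3}) →
    IsResiduallyCyclotomicBorel ℓ r ![0, 1, 2, 3] ∧
      ∀ v : HeightOneSpectrum (𝓞 ℚ), ((ℓ : ℕ) : 𝓞 ℚ) ∈ v.asIdeal →
        r.IsCrystallineOrdinaryOfShapeAt v ![0, 1, 2, 3]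

/-- **Symplectic Skinner–Wiles for `GSp₄` at the Borel point** (card `borel-void-skinner-wiles`, the
line's ONE NEW THEOREM — not in print): an absolutely irreducible symplectic `r : Γ_ℚ → GL₄(ℚ̄_ℓ)`,
unramified outside `ℓ`, crystalline-ordinary of shape `(0,1,2,3)` at `ℓ`, residually cyclotomic-Borel
with exponents pairwise distinct mod `ℓ - 1`, is automorphic: there are a regular algebraic cuspidal
`π` on `GL₄(𝔸_ℚ)` unramified at `ℓ` and `ι : ℚ̄_ℓ ≃ ℂ` with `r` Satake–Frobenius compatible with
`(π, ι)` a.e. (HLTT normalisation `m = 4`, the crux's). OPEN (Skinner–Wiles 1999 is `GL₂`). -/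
def BorelSkinnerWilesGSp4 : Prop :=
  ∀ (r : FramedGaloisRep ℚ (PadicAlgCl ℓ) 4) (a : Fin 4 → ℕ),
    FramedRep.IsAbsolutelyIrreducible r →
    (∃ ν : Field.absoluteGaloisGroup ℚ → PadicAlgCl ℓ, r.IsSymplecticWithMultiplierFun ν) →
    (∀ v : HeightOneSpectrum (𝓞 ℚ), ((ℓ : ℕ) : 𝓞 ℚ) ∉ v.asIdeal → r.IsUnramifiedAt v) →
    (∀ v : HeightOneSpectrum (𝓞 ℚ), ((ℓ : ℕ) : 𝓞 ℚ) ∈ v.asIdeal →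
      r.IsCrystallineOrdinaryOfShapeAt v ![0, 1, 2, 3]) →
    (∀ i j : Fin 4, i ≠ j → a i % (ℓ - 1) ≠ a j % (ℓ - 1)) →
    IsResiduallyCyclotomicBorel ℓ r a →
    ∃ (hcpt : isCompact_glFiniteIntegralLevel 4 ℚ) (π : CuspidalAutomorphicRepData 4 ℚ hcpt)
      (ι : PadicAlgCl ℓ ≃+* ℂ),
      π.1.IsRegularAlgebraic ∧
      (∀ v : HeightOneSpectrum (𝓞 ℚ), ((ℓ : ℕ) : 𝓞 ℚ) ∈ v.asIdeal → π.1.IsUnramifiedAt v) ∧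
      ∀ᶠ v : HeightOneSpectrum (𝓞 ℚ) in Filter.cofinite, ∃ s : Multiset ℂ,
        π.1.HasSatakeParamAt v s ∧ r.IsUnramifiedAt v ∧
          r.HasFrobCharpolyAt v (arithFrobPolyOfSatake ι v.residueCard 4 s)

end Engines

/-- **Polarisation of the quadratic restriction** (card `unitary-detour-yoshida`, first lemma; pure
matrix algebra, consumed by every unitary-type lifting theorem): if `r : Γ_ℚ → GL₄(A)` is symplectic
with multiplier `ν`, then for every Galois number field `K` and `τ ∈ Γ_ℚ` the conjugate `(r|_K)^τ`
is `ν • g (r|_K)⁻ᵀ g⁻¹` for some frame `g` (take `g = r(τ̃) J⁻¹`). -/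
def RestrictionIsPolarized : Prop :=
  ∀ (A : Type) [CommRing A] [TopologicalSpace A] [IsTopologicalRing A]
    (K : Type) [Field K] [NumberField K] [IsGalois ℚ K]
    (r : FramedGaloisRep ℚ A 4) (ν : Field.absoluteGaloisGroup ℚ → A),
    r.IsSymplecticWithMultiplierFun ν →
    ∀ τ : Field.absoluteGaloisGroup ℚ, ∃ g : GL (Fin 4) A, ∀ σ : Field.absoluteGaloisGroup K,
      ((r.restrictField K).outerConj τ σ).val =
        ν (absGaloisRestrict ℚ K σ) • (g.val * ((r.restrictField K σ)⁻¹).val.transpose * (g⁻¹).val)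

/-- **Arithmetic of the Coxeter torus order** (card `singer-type-evaporation` (1)): for an odd prime
`p`, `(p²+1)/2` is odd and every odd prime factor of `p²+1` is `≡ 1 (mod 4)` — so the evaporation
switches happen at primes `P ≥ 5`, never at `2` or `3`. -/
def CoxeterOrderArith : Prop :=
  ∀ p : ℕ, p.Prime → p ≠ 2 →
    Odd ((p ^ 2 + 1) / 2) ∧ ∀ q : ℕ, q.Prime → q ∣ p ^ 2 + 1 → q ≠ 2 → q % 4 = 1

/-! ## Stubs (registered; sorries live ONLY here) -/

/-- stub 1/7 — LANDED as p147310 (ACCEPTED, commit cd581afcbe9d): tree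
`Summits/Langlands/Langlands/Theorems/AbelianSurfaceSerreSerreGSp4SurjectiveStubRestrictionIsPolarized.lean`,
decl `Summit.Langlands.Langlands.Cruxes.SerreGSp4Surjective.Sketch.stub_restrictionIsPolarized` (sorry-free there; the
`sorry` below only stands in for the import, which this workfile record does not take). -/
theorem stub_restrictionIsPolarized :
    ∀ (A : Type) [CommRing A] [TopologicalSpace A] [IsTopologicalRing A]
      (K : Type) [Field K] [NumberField K] [IsGalois ℚ K]
      (r : FramedGaloisRep ℚ A 4) (ν : Field.absoluteGaloisGroup ℚ → A),
      r.IsSymplecticWithMultiplierFun ν →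
      ∀ τ : Field.absoluteGaloisGroup ℚ, ∃ g : GL (Fin 4) A, ∀ σ : Field.absoluteGaloisGroup K,
        ((r.restrictField K).outerConj τ σ).val =
          ν (absGaloisRestrict ℚ K σ) •
            (g.val * ((r.restrictField K σ)⁻¹).val.transpose * (g⁻¹).val) := by
  sorry

/-- stub 2/7 — LANDED as p147171 (ACCEPTED, commit 1c23a0b40d43): tree
`Summits/Langlands/Langlands/Theorems/AbelianSurfaceSerreSerreGSp4SurjectiveStubCoxeterOrderArith.lean`,
decl `Summit.Langlands.Langlands.Cruxes.SerreGSp4Surjective.Sketch.stub_coxeterOrderArith` (sorry-free there). -/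
theorem stub_coxeterOrderArith :
    ∀ p : ℕ, p.Prime → p ≠ 2 →
      Odd ((p ^ 2 + 1) / 2) ∧ ∀ q : ℕ, q.Prime → q ∣ p ^ 2 + 1 → q ≠ 2 → q % 4 = 1 := by
  sorry

/-- stub 3/7 — Fontaine's void in Borel form at `7` (in print modulo the FL ordinary-lattice step;
unvendored). -/
theorem stub_fontaineVoidBorel : FontaineVoidBorel 7 := by
  sorry

/-- stub 4/7 — symplectic Skinner–Wiles for `GSp₄` at the Borel point, `ℓ = 7` (NOT IN PRINT). -/
theorem stub_borelSkinnerWiles : BorelSkinnerWilesGSp4 7 := by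
  sorry

/-- stub 5/7 — LEVEL ONE from the two engines and the torus arithmetic: first lift potentially
crystalline of parallel weight `{0,1,2,3}` with Coxeter type at `p` (FKP lifting; Lee arXiv:2304.13879
non-vanishing of the tame potentially crystalline ring), compatible system (BLGGT §5 / BCGP 2021),
evaporation of the type at the primes `P ∣ d` (FL automorphy lifting, BLGGT Thm 4.2.1, adequacy
`P ≥ 10` or by hand at `5`; image kept big by the torus element, KLS; Størmer for `p ≥ p₀`), reduction
of the level-one weight-`[0,3]` system at `7`, void ⇒ Borel ordinary distinguished residue, Skinner–Wiles
⇒ the `7`-adic member is automorphic ⇒ the whole system is (Chebotarev + Brauer–Nesbitt), and at `p`: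
dévissage to a Serre weight + Gee–Geraghty ordinary companion forms give the crux's ordinary `π` of
level prime to `p` and the ordinary `r` (Hida theory, BCGP 2021 §7). Every named input UNVENDORED. -/
theorem stub_levelOne_of (harith : CoxeterOrderArith) (hvoid : FontaineVoidBorel 7)
    (hsw : BorelSkinnerWilesGSp4 7) : LevelOneSerre := by
  sorry

/-- stub 6/7 — THEN LEVEL: Khare-style induction on the primes `q ∣ N(ρ̄)`, `q ≥ 5`, tame: kill `q`
by switching INTO `q` in parallel weight (tamely potentially crystalline `GSp₄` lifting at `q`: Lee
Thm 1.5.1/1.5.3/1.5.6, generic tame only; small-`e` tame via BLGGT over the splitting field), images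
kept big by a Khare–Larsen–Savin scar `q₀` killed LAST at characteristic `q₀` where `LevelOneSerre`
is image-blind; ordinary Yoshida-type reducible residues met on the way go through the unitary detour
(`RestrictionIsPolarized` + Allen–Newton–Thorne arXiv:1912.11269 Thm 1.1 + quadratic descent). -/
theorem stub_levelInduction (hpol : RestrictionIsPolarized) (hone : LevelOneSerre) :
    TameSliceSerre := by
  sorry

/-- stub 7/7 — the complement slice (ramified above `2` or `3`, or wild above some `q ≠ p`): NO ENGINE
named by any card of the line (BN3); typed so that the transfer gap is a registered obligation. -/
theorem stub_wildSlice : WildSliceSerre := by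
  sorry

/-! ## Composition -/

/-- The two slices give the crux (pure logic: `max` of the two thresholds, case split on the slice). -/
theorem serreGSp4Surjective_of_slices (hT : TameSliceSerre) (hW : WildSliceSerre) :
    Summit.Langlands.Langlands.Theses.AbelianSurfaceSerre.SerreGSp4Surjective := by
  obtain ⟨p₁, h₁⟩ := hT
  obtain ⟨p₂, h₂⟩ := hW
  refine ⟨max p₁ p₂, fun p _ hp ρ hH1 hH2 => ?_⟩
  by_cases hs : IsSixGoodTame p ρ
  · exact h₁ p ((le_max_left p₁ p₂).trans hp) ρ hH1 hH2 hs
  · exact h₂ p ((le_max_right p₁ p₂).trans hp) ρ hH1 hH2 hs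

/-- **The line closes the crux modulo its stubs**: `SerreGSp4Surjective` from the seven registered
stubs (conclusion is the crux BY NAME). -/
theorem SerreGSp4Surjective_of :
    Summit.Langlands.Langlands.Theses.AbelianSurfaceSerre.SerreGSp4Surjective :=
  serreGSp4Surjective_of_slices
    (stub_levelInduction stub_restrictionIsPolarized
      (stub_levelOne_of stub_coxeterOrderArith stub_fontaineVoidBorel stub_borelSkinnerWiles))
    stub_wildSlice

end

end Summit.Langlands.Langlands.Cruxes.SerreGSp4Surjective.Sketch
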